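import Literature.Computability.AlgebraicComplexity.LMR13TangentAtDet
import Literature.Computability.AlgebraicComplexity.LMR13ImmanantsTangent
import Literature.LinearAlgebra.Matrix.PermanentSubperm
import HarnessLib

/-!
# Landsberg–Manivel–Ressayre 2013, Prop. 3.4.2 at `n = 3`: the permanent `per_3 = IM_{(3)}` is NOT
# tangent to `𝒟ual_{4,3,9}` at `det_3` — a kernel certificate

Cell `val-lit`, row `LMR13-A`, item (X4b) (val-lit-p8 g3). Honest framing: one explicit numerical
certificate inside the typed literature of LMR 2013; VP ≠ VNP is NOT proved and nothing here is
progress on it.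

LMR 2013 Prop. 3.4.2 (journal p. 479) asserts `P_n = {1ⁿ, 21^{n−2}}`; at `n = 3` this says in
particular that `(3) ∉ P_3`, i.e. the permanent `IM_{(3)} = per_3` does not lie in the affine Zariski
tangent space `T̂_{[det_3]}𝒟ual_{4,3,9}` (`lmrZariskiTangent 4 3 (detPoly (Fin 3) ℂ)`). The printed
proof (Lemma 3.4.1, four pairwise distinct indices `i, p, q, n`) is vacuous for `n = 3`, so this case
of the typed named fact `LMR2013_prop_3_4_2` needs a separate certificate; here it is, straight from
the definition of `lmrZariskiTangent` (the `ε¹`-coefficient of one remainder equation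
`E_{B,u,v}(det_3 + ε per_3)` is `12 ≠ 0`).

The datum: `u = [[1,1,1],[1,0,0],[1,0,0]]` (a COMMON root of `det_3` and `per_3`, so that the
root formula `lmrDualEquation_of_eval_eq_zero` of `LMR13FirstOrderIdentity.lean` applies over the ring
`ℂ[ε]` to `P_ε = det_3 + ε per_3`), `v = E_{12}` (`⟨∇det_3(u), v⟩ = 1`), and the `7 × 9` frame `B`
with rows `E_{01}, E_{02}, E_{10}, E_{11}, E_{12}, E_{21}` and `b₇ = [[0,1,1],[0,1,1],[0,1,1]]`; `b₇`
lies in the radical of the Hessian form of `det_3` at `u` (LMR Lemma 3.3.1: `b₇ = C Z R` with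
`tr Z = 0`) while `b₇ᵀ · Hess(per_3)(u) · b₇ = 12`. Then `B · Hess(P_ε)(u) · Bᵀ = N₀ + ε N₁` with
the last row and column of `N₀` zero, so `det(N₀ + εN₁) = ε · det(N₀') · (N₁)₇₇ + O(ε²)` with
`det N₀' = −1`, `(N₁)₇₇ = 12`, and `E = det(…)·(−1)⁵·(1 + ε)⁵` has `ε¹`-coefficient `12`.
(Degenerate data do NOT work: at `u = diag(1,1,0)`, or at any `u` with a zero row, the Hessian form
of `per_3` vanishes on the radical of that of `det_3`, and the coefficient is `0` for every frame.)

Contents: `detPoly_fin_three` / `perPoly_fin_three` (explicit expansions), the two Hessians at `u`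
(`hessianMatrix_detPoly_certPoint`, `hessianMatrix_perPoly_certPoint`, as integer tables; private),
the integer matrix algebra by `decide`, and the certificate **`perPoly_not_mem_lmrZariskiTangent_three`**,
restated for the immanant as `immanant_indiscrete_three_not_mem_lmrZariskiTangent` (`IM_{(3)} = per_3`,
`immanant_indiscrete`). The first-order calculus of `P + επ` over `ℂ[ε]`
(`eval_C_comp_firstOrderDeformation`, `pderiv_firstOrderDeformation`,
`eval_C_comp_hessGenMinor_firstOrderDeformation`, `coeff_one_det_map_C_add_X_smul`) is val-lit-p7's
(`LMR13ZariskiTangentDivisibility.lean`, `LMR13TangentAtDet.lean`), the root formula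
`lmrDualEquation_of_eval_eq_zero` is val-lit-t17's (`LMR13FirstOrderIdentity.lean`).

## References
* [LandsbergManivelRessayre2013] J. M. Landsberg, L. Manivel, N. Ressayre, *Hypersurfaces with
  degenerate duals and the Geometric Complexity Theory Program*, Comment. Math. Helv. 88 (2013)
  469–484, §3.3 (the tangent space), Prop. 3.4.2 (p. 479).

## Mathlib and tree
Mathlib: `Matrix.det_fin_three`, `RingHom.map_det`, `Matrix.det_eq_zero_of_row_eq_zero`,
`IsUnit.of_mul_eq_one`, `decide` for the integer matrix identities. Tree:
`lmrDualEquation_of_eval_eq_zero` (`LMR13FirstOrderIdentity.lean`, val-lit-t17);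
`eval_C_comp_firstOrderDeformation`, `pderiv_firstOrderDeformation`, `isHomogeneous_firstOrderDeformation`
(`LMR13ZariskiTangentDivisibility.lean`, val-lit-p7); `eval_C_comp_hessGenMinor_firstOrderDeformation`,
`coeff_one_det_map_C_add_X_smul` (`LMR13TangentAtDet.lean`, val-lit-p7); `hessianMatrix`,
`firstOrderDeformation`, `lmrZariskiTangent`, `detPoly_isHomogeneous`, `perPoly_isHomogeneous`,
`Matrix.permanent_fin_three_row` (`Literature/LinearAlgebra/Matrix/PermanentSubperm.lean`),
`immanant_indiscrete` (`LMR13ImmanantsTangent.lean`).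
-/

noncomputable section

open MvPolynomial

namespace Literature.Computability.AlgebraicComplexity

/-! ### Explicit expansions of `det_3` and `per_3` -/

section Expansions

variable (R : Type*) [CommRing R]

/-- `det_3` written out (rule of Sarrus). [cite: LandsbergManivelRessayre2013, §3.4 (p. 478)] -/
theorem detPoly_fin_three :
    detPoly (Fin 3) R = X (0, 0) * X (1, 1) * X (2, 2) - X (0, 0) * X (1, 2) * X (2, 1)
      - X (0, 1) * X (1, 0) * X (2, 2) + X (0, 1) * X (1, 2) * X (2, 0)
      + X (0, 2) * X (1, 0) * X (2, 1) - X (0, 2) * X (1, 1) * X (2, 0) := by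
  rw [detPoly, Matrix.det_fin_three]
  rfl

/-- `per_3` written out (expansion along the first row). [cite: LandsbergManivelRessayre2013, §3.4 (p. 478)] -/
theorem perPoly_fin_three :
    perPoly (Fin 3) R = X (0, 0) * (X (1, 1) * X (2, 2) + X (1, 2) * X (2, 1))
      + X (0, 1) * (X (1, 0) * X (2, 2) + X (1, 2) * X (2, 0))
      + X (0, 2) * (X (1, 0) * X (2, 1) + X (1, 1) * X (2, 0)) := by
  rw [perPoly, Matrix.permanent_fin_three_row]
  rfl

end Expansions

/-! ### One more coefficient of `det(N₀ + εN₁)` -/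

section FirstOrder

/-- The constant term of a first-order matrix: `(N₀ + εN₁)(0) = N₀`. [folklore] -/
private theorem map_eval_zero_map_C_add_X_smul {R : Type*} [CommRing R] {m n : Type*}
    (N₀ N₁ : Matrix m n R) :
    (N₀.map (Polynomial.C : R →+* Polynomial R) +
        (Polynomial.X : Polynomial R) • N₁.map (Polynomial.C : R →+* Polynomial R)).map
      (Polynomial.eval 0) = N₀ := by
  ext i j
  simp

/-- The constant term `det(N₀ + εN₁)(0) = det N₀` vanishes when a row of `N₀` does (companion of
`coeff_one_det_map_C_add_X_smul`, `LMR13TangentAtDet.lean`). [folklore] -/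
private theorem coeff_zero_det_map_C_add_X_smul_of_row {R : Type*} [CommRing R] {m : ℕ}
    (N₀ N₁ : Matrix (Fin (m + 1)) (Fin (m + 1)) R) (hrow : ∀ j, N₀ (Fin.last m) j = 0) :
    (Matrix.det (N₀.map (Polynomial.C : R →+* Polynomial R) +
        (Polynomial.X : Polynomial R) • N₁.map (Polynomial.C : R →+* Polynomial R))).coeff 0 = 0 := by
  rw [Polynomial.coeff_zero_eq_eval_zero, ← Polynomial.coe_evalRingHom, RingHom.map_det,
    RingHom.mapMatrix_apply, Polynomial.coe_evalRingHom, map_eval_zero_map_C_add_X_smul]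
  exact Matrix.det_eq_zero_of_row_eq_zero (Fin.last m) hrow

end FirstOrder

/-! ### The datum `(B, u, v)` and the two Hessians at `u` -/

section Datum

/-- The common root `u = [[1,1,1],[1,0,0],[1,0,0]]` of `det_3` and `per_3` (first row and first
column all ones). [cite: LandsbergManivelRessayre2013, Proposition 3.4.2 (p. 479)] -/
private def certPoint : Fin 3 × Fin 3 → ℂ := fun p => if p.1 = 0 ∨ p.2 = 0 then 1 else 0

/-- The direction `v = E_{12}`. [cite: LandsbergManivelRessayre2013, Proposition 3.4.2 (p. 479)] -/
private def certDir : Fin 3 × Fin 3 → ℂ := fun p => if p = (1, 2) then 1 else 0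

/-- The frame: rows `E_{01}, E_{02}, E_{10}, E_{11}, E_{12}, E_{21}` and `b₇ = [[0,1,1],[0,1,1],[0,1,1]]`
(integer entries). [cite: LandsbergManivelRessayre2013, Proposition 3.4.2 (p. 479)] -/
private def certFrameZ : Matrix (Fin 7) (Fin 3 × Fin 3) ℤ :=
  Matrix.of fun r p =>
    if (r : ℕ) < 6 then (if p = (![(0, 1), (0, 2), (1, 0), (1, 1), (1, 2), (2, 1)] : Fin 6 → Fin 3 × Fin 3)
        ⟨(r : ℕ) % 6, Nat.mod_lt _ (by norm_num)⟩ then 1 else 0)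
    else (if p.2 = 0 then 0 else 1)

/-- The Hessian of `det_3` at `u`, as an integer table. [cite: LandsbergManivelRessayre2013, §3.3 (p. 478)] -/
private def hessDetTab : Fin 3 → Fin 3 → Fin 3 → Fin 3 → ℤ :=
  ![![![![0, 0, 0], ![0, 0, 0], ![0, 0, 0]], ![![0, 0, 0], ![0, 0, 1], ![0, 0, -1]], ![![0, 0, 0], ![0, -1, 0], ![0, 1, 0]]],
    ![![![0, 0, 0], ![0, 0, 0], ![0, 1, -1]], ![![0, 0, -1], ![0, 0, 0], ![-1, 0, 1]], ![![0, 1, 0], ![0, 0, 0], ![1, -1, 0]]],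
    ![![![0, 0, 0], ![0, -1, 1], ![0, 0, 0]], ![![0, 0, 1], ![1, 0, -1], ![0, 0, 0]], ![![0, -1, 0], ![-1, 1, 0], ![0, 0, 0]]]]

/-- The Hessian of `per_3` at `u`, as an integer table. [cite: LandsbergManivelRessayre2013, §3.3 (p. 478)] -/
private def hessPerTab : Fin 3 → Fin 3 → Fin 3 → Fin 3 → ℤ :=
  ![![![![0, 0, 0], ![0, 0, 0], ![0, 0, 0]], ![![0, 0, 0], ![0, 0, 1], ![0, 0, 1]], ![![0, 0, 0], ![0, 1, 0], ![0, 1, 0]]],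
    ![![![0, 0, 0], ![0, 0, 0], ![0, 1, 1]], ![![0, 0, 1], ![0, 0, 0], ![1, 0, 1]], ![![0, 1, 0], ![0, 0, 0], ![1, 1, 0]]],
    ![![![0, 0, 0], ![0, 1, 1], ![0, 0, 0]], ![![0, 0, 1], ![1, 0, 1], ![0, 0, 0]], ![![0, 1, 0], ![1, 1, 0], ![0, 0, 0]]]]

/-- The Hessian of `det_3` at `u` as an integer matrix. [cite: LandsbergManivelRessayre2013, §3.3 (p. 478)] -/
private def hessDetZ : Matrix (Fin 3 × Fin 3) (Fin 3 × Fin 3) ℤ :=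
  Matrix.of fun p q => hessDetTab p.1 p.2 q.1 q.2

/-- The Hessian of `per_3` at `u` as an integer matrix. [cite: LandsbergManivelRessayre2013, §3.3 (p. 478)] -/
private def hessPerZ : Matrix (Fin 3 × Fin 3) (Fin 3 × Fin 3) ℤ :=
  Matrix.of fun p q => hessPerTab p.1 p.2 q.1 q.2

/-- `N₀ = B · Hess(det_3)(u) · Bᵀ` (last row and column zero: `b₇` is in the radical).
[cite: LandsbergManivelRessayre2013, Lemma 3.3.1 (p. 478)] -/
private def n0Z : Matrix (Fin 7) (Fin 7) ℤ :=
  !![0, 0, 0, 0, 1, 0, 0;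
    0, 0, 0, -1, 0, 1, 0;
    0, 0, 0, 0, 0, 1, 0;
    0, -1, 0, 0, 0, 0, 0;
    1, 0, 0, 0, 0, -1, 0;
    0, 1, 1, 0, -1, 0, 0;
    0, 0, 0, 0, 0, 0, 0]

/-- `N₁ = B · Hess(per_3)(u) · Bᵀ` (corner entry `b₇ᵀ Hess(per_3)(u) b₇ = 12`).
[cite: LandsbergManivelRessayre2013, Proposition 3.4.2 (p. 479)] -/
private def n1Z : Matrix (Fin 7) (Fin 7) ℤ :=
  !![0, 0, 0, 0, 1, 0, 2;
    0, 0, 0, 1, 0, 1, 2;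
    0, 0, 0, 0, 0, 1, 2;
    0, 1, 0, 0, 0, 0, 2;
    1, 0, 0, 0, 0, 1, 2;
    0, 1, 1, 0, 1, 0, 2;
    2, 2, 2, 2, 2, 2, 12]

/-- An integer inverse of the leading `6 × 6` block of `N₀` (so that block has determinant `±1`).
[folklore] -/
private def m6Inv : Matrix (Fin 6) (Fin 6) ℤ :=
  !![0, 0, 1, 0, 1, 0;
    0, 0, 0, -1, 0, 0;
    1, 0, 0, 1, 0, 1;
    0, -1, 1, 0, 0, 0;
    1, 0, 0, 0, 0, 0;
    0, 0, 1, 0, 0, 0]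

-- 81 entries, each a short symbolic differentiation: the default heartbeat budget is too small
-- for the whole `fin_cases` cascade (no single entry is expensive).
set_option maxHeartbeats 1600000 in
/-- **`Hess(det_3)(u)`** entry by entry. [cite: LandsbergManivelRessayre2013, §3.3 (p. 478)] -/
private theorem hessianMatrix_detPoly_certPoint :
    hessianMatrix (detPoly (Fin 3) ℂ) certPoint = hessDetZ.map (Int.castRingHom ℂ) := by
  ext ⟨a, b⟩ ⟨c, d⟩
  fin_cases a <;> fin_cases b <;> fin_cases c <;> fin_cases d <;>
    simp [hessianMatrix_apply, detPoly_fin_three, certPoint, pderiv_X, hessDetZ, hessDetTab, Matrix.map_apply]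

set_option maxHeartbeats 1600000 in
/-- **`Hess(per_3)(u)`** entry by entry. [cite: LandsbergManivelRessayre2013, §3.3 (p. 478)] -/
private theorem hessianMatrix_perPoly_certPoint :
    hessianMatrix (perPoly (Fin 3) ℂ) certPoint = hessPerZ.map (Int.castRingHom ℂ) := by
  ext ⟨a, b⟩ ⟨c, d⟩
  fin_cases a <;> fin_cases b <;> fin_cases c <;> fin_cases d <;>
    simp [hessianMatrix_apply, perPoly_fin_three, certPoint, pderiv_X, hessPerZ, hessPerTab, Matrix.map_apply]

/-- The integer matrix algebra of the certificate, checked by `decide`. [folklore] -/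
private theorem certFrameZ_mul_hessDetZ : certFrameZ * hessDetZ * certFrameZ.transpose = n0Z := by
  decide

/-- The integer matrix algebra of the certificate, checked by `decide`. [folklore] -/
private theorem certFrameZ_mul_hessPerZ : certFrameZ * hessPerZ * certFrameZ.transpose = n1Z := by
  decide

/-- The leading block of `N₀` is unimodular. [folklore] -/
private theorem n0Z_block_mul_inv : n0Z.submatrix Fin.castSucc Fin.castSucc * m6Inv = 1 := by
  decide

/-- `det_3(u) = 0`. [cite: LandsbergManivelRessayre2013, Proposition 3.4.2 (p. 479)] -/
private theorem eval_detPoly_certPoint : eval certPoint (detPoly (Fin 3) ℂ) = 0 := by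
  simp [detPoly_fin_three, certPoint]

/-- `per_3(u) = 0`. [cite: LandsbergManivelRessayre2013, Proposition 3.4.2 (p. 479)] -/
private theorem eval_perPoly_certPoint : eval certPoint (perPoly (Fin 3) ℂ) = 0 := by
  simp [perPoly_fin_three, certPoint]

/-- `⟨∇det_3(u), v⟩ = ∂_{12}det_3(u) = 1`. [cite: LandsbergManivelRessayre2013, Proposition 3.4.2 (p. 479)] -/
private theorem sum_certDir_mul_eval_pderiv_detPoly :
    ∑ i : Fin 3 × Fin 3, certDir i * eval certPoint (pderiv i (detPoly (Fin 3) ℂ)) = 1 := by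
  rw [Finset.sum_eq_single (1, 2)]
  · simp [certDir, detPoly_fin_three, certPoint, pderiv_X]
  · intro i _ hi
    simp [certDir, hi]
  · intro h
    exact absurd (Finset.mem_univ _) h

end Datum

/-! ### The certificate -/

section Certificate

/-- **`per_3 ∉ T̂_{[det_3]}𝒟ual_{4,3,9}`** — LMR 2013 Prop. 3.4.2 at `n = 3` for the partition `(3)`:
the `ε¹`-coefficient of the remainder equation `E_{B,u,v}(det_3 + ε per_3)` of the datum above is
`12 ≠ 0`. [cite: LandsbergManivelRessayre2013, Proposition 3.4.2 (p. 479)] -/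
theorem perPoly_not_mem_lmrZariskiTangent_three :
    perPoly (Fin 3) ℂ ∉ lmrZariskiTangent 4 3 (detPoly (Fin 3) ℂ) := by
  classical
  intro hmem
  set B : Matrix (Fin 7) (Fin 3 × Fin 3) ℂ := certFrameZ.map (Int.castRingHom ℂ) with hB
  have h := hmem.2 B certPoint certDir
  -- the deformed form and its root `u`
  set Pε := firstOrderDeformation (detPoly (Fin 3) ℂ) (perPoly (Fin 3) ℂ) with hPε
  set uε : Fin 3 × Fin 3 → Polynomial ℂ := fun i => Polynomial.C (certPoint i) with huε
  set vε : Fin 3 × Fin 3 → Polynomial ℂ := fun i => Polynomial.C (certDir i) with hvε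
  set Bε : Matrix (Fin 7) (Fin 3 × Fin 3) (Polynomial ℂ) :=
    B.map (Polynomial.C : ℂ →+* Polynomial ℂ) with hBε
  have hdet3 : (detPoly (Fin 3) ℂ).IsHomogeneous 3 := by
    simpa only [Fintype.card_fin] using (detPoly_isHomogeneous : (detPoly (Fin 3) ℂ).IsHomogeneous _)
  have hper3 : (perPoly (Fin 3) ℂ).IsHomogeneous 3 := by
    simpa only [Fintype.card_fin] using (perPoly_isHomogeneous : (perPoly (Fin 3) ℂ).IsHomogeneous _)
  have hPεhom : Pε.IsHomogeneous 3 := isHomogeneous_firstOrderDeformation hdet3 hper3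
  have hroot : eval uε Pε = 0 := by
    rw [huε, hPε, eval_C_comp_firstOrderDeformation, eval_detPoly_certPoint, eval_perPoly_certPoint]
    simp
  -- the root formula for `E_{B,u,v}(P_ε)` over `ℂ[ε]`
  have hE := lmrDualEquation_of_eval_eq_zero (κ := 4) (le_refl 3) hPεhom Bε uε vε hroot
  rw [hE] at h
  -- the Hessian sandwich `B · Hess(P_ε)(u) · Bᵀ = N₀ + ε N₁`
  have h0 : B * hessianMatrix (detPoly (Fin 3) ℂ) certPoint * B.transpose =
      n0Z.map (Int.castRingHom ℂ) := by
    rw [hB, hessianMatrix_detPoly_certPoint, ← certFrameZ_mul_hessDetZ, Matrix.map_mul, Matrix.map_mul,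
      Matrix.transpose_map]
  have h1 : B * hessianMatrix (perPoly (Fin 3) ℂ) certPoint * B.transpose =
      n1Z.map (Int.castRingHom ℂ) := by
    rw [hB, hessianMatrix_perPoly_certPoint, ← certFrameZ_mul_hessPerZ, Matrix.map_mul, Matrix.map_mul,
      Matrix.transpose_map]
  have hHess : eval uε (hessGenMinor Bε Bε Pε) =
      Matrix.det ((n0Z.map (Int.castRingHom ℂ)).map (Polynomial.C : ℂ →+* Polynomial ℂ) +
        (Polynomial.X : Polynomial ℂ) •
          (n1Z.map (Int.castRingHom ℂ)).map (Polynomial.C : ℂ →+* Polynomial ℂ)) := by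
    rw [huε, hBε, hPε, eval_C_comp_hessGenMinor_firstOrderDeformation, h0, h1]
  have hrowZ : ∀ j, n0Z (Fin.last 6) j = 0 := by decide
  have hcolZ : ∀ i, n0Z i (Fin.last 6) = 0 := by decide
  have hrow : ∀ j, n0Z.map (Int.castRingHom ℂ) (Fin.last 6) j = 0 := fun j => by
    rw [Matrix.map_apply, hrowZ j, map_zero]
  have hcol : ∀ i, n0Z.map (Int.castRingHom ℂ) i (Fin.last 6) = 0 := fun i => by
    rw [Matrix.map_apply, hcolZ i, map_zero]
  have h12 : n1Z.map (Int.castRingHom ℂ) (Fin.last 6) (Fin.last 6) = 12 := by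
    have : n1Z (Fin.last 6) (Fin.last 6) = 12 := by decide
    rw [Matrix.map_apply, this]
    norm_num
  have hcoeff1 : (eval uε (hessGenMinor Bε Bε Pε)).coeff 1 =
      Matrix.det ((n0Z.map (Int.castRingHom ℂ)).submatrix Fin.castSucc Fin.castSucc) * 12 := by
    rw [hHess, coeff_one_det_map_C_add_X_smul _ _ hrow hcol, h12]
  have hcoeff0 : (eval uε (hessGenMinor Bε Bε Pε)).coeff 0 = 0 := by
    rw [hHess]
    exact coeff_zero_det_map_C_add_X_smul_of_row _ _ hrow
  -- the gradient factor `(Σ v_i ∂_i P_ε (u))^5` has constant term `1`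
  have hgrad0 : (∑ i, vε i * eval uε (pderiv i Pε)).coeff 0 = 1 := by
    rw [Polynomial.finsetSum_coeff]
    have : ∀ i : Fin 3 × Fin 3, (vε i * eval uε (pderiv i Pε)).coeff 0 =
        certDir i * eval certPoint (pderiv i (detPoly (Fin 3) ℂ)) := by
      intro i
      rw [hvε, huε, hPε, pderiv_firstOrderDeformation, eval_C_comp_firstOrderDeformation]
      simp
    simp only [this, sum_certDir_mul_eval_pderiv_detPoly]
  -- the leading block of `N₀` is unimodular
  have hblock : Matrix.det ((n0Z.map (Int.castRingHom ℂ)).submatrix Fin.castSucc Fin.castSucc) ≠ 0 := by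
    have hZ : IsUnit (Matrix.det (n0Z.submatrix Fin.castSucc Fin.castSucc)) := by
      refine IsUnit.of_mul_eq_one (Matrix.det m6Inv) ?_
      rw [← Matrix.det_mul, n0Z_block_mul_inv, Matrix.det_one]
    rw [Matrix.submatrix_map, ← RingHom.mapMatrix_apply, ← RingHom.map_det, eq_intCast]
    exact Int.cast_ne_zero.2 hZ.ne_zero
  -- the constant term of the second factor: `((−1)^5 · (Σ v_i ∂_iP_ε(u))^5)(0) = −1`
  have hrest : ((-1 : Polynomial ℂ) ^ 5 * (∑ i, vε i * eval uε (pderiv i Pε)) ^ 5).coeff 0 = -1 := by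
    rw [Polynomial.coeff_zero_eq_eval_zero, Polynomial.eval_mul, Polynomial.eval_pow,
      Polynomial.eval_pow, Polynomial.eval_neg, Polynomial.eval_one,
      ← Polynomial.coeff_zero_eq_eval_zero, hgrad0]
    norm_num
  -- assemble the `ε¹`-coefficient: `coeff₁(E) = det(N₀') · 12 · (−1) ≠ 0`
  have hexp : (4 + 3) * (3 - 2) - 3 + 1 = 5 := by norm_num
  rw [hexp, Polynomial.coeff_mul, Finset.Nat.antidiagonal_succ, Finset.sum_cons,
    Finset.Nat.antidiagonal_zero, Finset.map_singleton, Finset.sum_singleton] at h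
  simp only [Function.Embedding.coe_prodMap, Function.Embedding.coeFn_mk, Prod.map_apply,
    Nat.succ_eq_add_one, Nat.reduceAdd, Function.Embedding.refl_apply] at h
  rw [hcoeff0, hcoeff1, zero_mul, zero_add, hrest] at h
  apply hblock
  linear_combination (-1 / 12 : ℂ) * h

/-- The same statement for the immanant of the one-row partition: **`IM_{(3)} ∉ T̂_{[det_3]}𝒟ual_{4,3,9}`**,
i.e. `(3) ∉ P_3` (LMR 2013 Prop. 3.4.2 at `n = 3`). [cite: LandsbergManivelRessayre2013, Proposition 3.4.2 (p. 479)] -/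
theorem immanant_indiscrete_three_not_mem_lmrZariskiTangent :
    immanant (Nat.Partition.indiscrete 3) ∉ lmrZariskiTangent 4 3 (detPoly (Fin 3) ℂ) := by
  rw [immanant_indiscrete]
  exact perPoly_not_mem_lmrZariskiTangent_three

end Certificate

end Literature.Computability.AlgebraicComplexity

end
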